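import Summits.CriticalPhenomena.SAWScalingLimit.Theorems.SAWLoopFugacityFlowAvoidancePassageCarving

/-!
# Carving finitely many bites; marked points of the carved domain

Support file for item `stmt-CriticalPhenomena-4984` (`AvoidancePassage`): finite bookkeeping
around `exists_carve` (`…Carving`).

* `mem_image_closedHalfDisc` — points of a charted closed half-disc `h(K_ρ)`, `ρ < 1`, are
  `h w` with `|w| < 1`, `im w > 0` (in the bite) or `h x` with `x` real, `|x| < 1` (on the shadow);
* `exists_carve_finset` — carving finitely many pairwise disjoint charted bites off `D` leaves a
  Jordan domain with carrier `D ∖ ⋃ᵢ h i (K_{ρ i})` (induction on the finite set);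
* `exists_dedupe` — from a finite family of sets any two of which are equal or disjoint, extract
  a pairwise disjoint subfamily with the same members up to equality;
* `isCompact_inter_of_cover` — `K ∩ cᵢ` is compact for a compact `K` covered by such a family of
  open sets;
* `exists_dobrushinDomain_of_mem_frontier` — a Jordan domain with two prescribed distinct frontier
  points is (the carrier of) a Dobrushin domain with these marked points (shift the loop).

All folklore; no new definitions.
-/

noncomputable section

namespace Summit.CriticalPhenomena.SAWScalingLimit.Theorems.AvoidancePassage

open Set Metric Filter Topology Complex
open UpperHalfPlane (upperHalfPlaneSet isOpen_upperHalfPlaneSet)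
open Literature.Topology.PlaneTopology
open Literature.Probability.RandomPlanarGeometry (JordanDomain DobrushinDomain MarkedDomain)

/-! ### Points of a charted closed half-disc -/

/-- A point of `h(closed upper half-disc of radius ρ)`, `ρ < 1`, is either `h w` with `|w| < 1`,
`im w > 0`, or `h x` with `x` real, `|x| < 1`. [folklore] -/
theorem mem_image_closedHalfDisc {h : ℂ ≃ₜ ℂ} {ρ : ℝ} (hρ1 : ρ < 1) {z : ℂ}
    (hz : z ∈ h '' (closedBall 0 ρ ∩ {w : ℂ | 0 ≤ w.im})) :
    (∃ w : ℂ, ‖w‖ < 1 ∧ 0 < w.im ∧ z = h w) ∨ (∃ x : ℝ, |x| < 1 ∧ z = h x) := by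
  obtain ⟨w, ⟨hwn, hwim⟩, rfl⟩ := hz
  rw [mem_closedBall, dist_zero_right] at hwn
  have hwim' : 0 ≤ w.im := hwim
  rcases hwim'.lt_or_eq with hpos | hzero
  · exact Or.inl ⟨w, lt_of_le_of_lt hwn hρ1, hpos, rfl⟩
  · refine Or.inr ⟨w.re, lt_of_le_of_lt ((abs_re_le_norm w).trans hwn) hρ1, ?_⟩
    rw [← eq_ofReal_re_of_im_eq_zero hzero.symm]

/-- The charted open half-disc lies in the charted closed half-disc. [folklore] -/
theorem image_halfDisc_subset_image_closed (h : ℂ ≃ₜ ℂ) (ρ : ℝ) :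
    h '' (ball 0 ρ ∩ upperHalfPlaneSet) ⊆ h '' (closedBall 0 ρ ∩ {w : ℂ | 0 ≤ w.im}) := by
  rintro _ ⟨w, ⟨hwn, hwim⟩, rfl⟩
  exact ⟨w, ⟨ball_subset_closedBall hwn, le_of_lt (show 0 < w.im from hwim)⟩, rfl⟩

/-! ### Carving finitely many bites -/

/-- **Carving finitely many pairwise disjoint bites.** Let `B i ⊆ D` be Jordan domains charted by
homeomorphisms `h i` of `ℂ` (`h i (𝔻 ∩ ℍ) = B i`, open diameter into `∂D`), pairwise disjoint
for `i` in the finite set `S`, and `0 < ρ i < 1`. Then `D ∖ ⋃_{i ∈ S} h i (K_{ρ i})` is the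
carrier of a Jordan domain. [folklore] -/
theorem exists_carve_finset {ι : Type*} (D : JordanDomain) (B : ι → JordanDomain)
    (h : ι → ℂ ≃ₜ ℂ) (ρ : ι → ℝ) (hρ0 : ∀ i, 0 < ρ i) (hρ1 : ∀ i, ρ i < 1)
    (hBD : ∀ i, (B i).carrier ⊆ D.carrier)
    (hhB : ∀ i, h i '' (ball 0 1 ∩ upperHalfPlaneSet) = (B i).carrier)
    (hdiam : ∀ i (x : ℝ), |x| < 1 → h i x ∈ frontier D.carrier) (S : Finset ι)
    (hpair : ∀ i ∈ S, ∀ j ∈ S, i ≠ j → Disjoint (B i).carrier (B j).carrier) :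
    ∃ J : JordanDomain,
      J.carrier = D.carrier \ ⋃ i ∈ S, h i '' (closedBall 0 (ρ i) ∩ {z : ℂ | 0 ≤ z.im}) := by
  classical
  induction S using Finset.induction_on with
  | empty => exact ⟨D, by simp⟩
  | insert a s has ih =>
    obtain ⟨Ω, hΩ⟩ := ih fun i hi j hj hij ↦
      hpair i (Finset.mem_insert_of_mem hi) j (Finset.mem_insert_of_mem hj) hij
    have hΩD : Ω.carrier ⊆ D.carrier := hΩ ▸ Set.sdiff_subset
    have hBΩ : (B a).carrier ⊆ Ω.carrier := by
      rw [hΩ]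
      intro z hz
      refine ⟨hBD a hz, fun hzU ↦ ?_⟩
      obtain ⟨i, hi, hzi⟩ := mem_iUnion₂.1 hzU
      have hne : a ≠ i := fun hai ↦ has (hai ▸ hi)
      rcases mem_image_closedHalfDisc (hρ1 i) hzi with ⟨w, hw1, hwim, rfl⟩ | ⟨x, hx, hzx⟩
      · exact Set.disjoint_left.1 (hpair a (Finset.mem_insert_self a s) i
          (Finset.mem_insert_of_mem hi) hne) hz (chart_mem_carrier (hhB i) hw1 hwim)
      · exact Set.disjoint_left.1 D.disjoint_carrier_frontier (hBD a hz) (hzx ▸ hdiam i x hx)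
    obtain ⟨J, hJ⟩ := exists_carve D Ω (B a) (h a) (hρ0 a) (hρ1 a) hΩD hBΩ (hhB a) (hdiam a)
    refine ⟨J, ?_⟩
    rw [hJ, hΩ, Finset.set_biUnion_insert, Set.sdiff_sdiff, union_comm]

/-! ### Finite combinatorics of equal-or-disjoint families -/

/-- **Deduplication.** From a finite family of sets any two of which are equal or disjoint one
extracts a pairwise disjoint subfamily representing every member. [folklore] -/
theorem exists_dedupe {ι : Type*} (S : Finset ι) (c : ι → Set ℂ)
    (hdich : ∀ i ∈ S, ∀ j ∈ S, c i = c j ∨ Disjoint (c i) (c j)) :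
    ∃ S' : Finset ι, S' ⊆ S ∧ (∀ i ∈ S', ∀ j ∈ S', i ≠ j → Disjoint (c i) (c j)) ∧
      ∀ i ∈ S, ∃ j ∈ S', c i = c j := by
  classical
  induction S using Finset.induction_on with
  | empty => exact ⟨∅, Finset.Subset.refl _, by simp, by simp⟩
  | insert a s has ih =>
    obtain ⟨S', hS', hpw, hcov⟩ := ih fun i hi j hj ↦
      hdich i (Finset.mem_insert_of_mem hi) j (Finset.mem_insert_of_mem hj)
    by_cases hex : ∃ j ∈ S', c a = c j
    · refine ⟨S', hS'.trans (Finset.subset_insert a s), hpw, fun i hi ↦ ?_⟩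
      rcases Finset.mem_insert.1 hi with hia | hi
      · rw [hia]; exact hex
      · exact hcov i hi
    · push Not at hex
      refine ⟨insert a S', Finset.insert_subset_insert a hS', fun i hi j hj hij ↦ ?_,
        fun i hi ↦ ?_⟩
      · rcases Finset.mem_insert.1 hi with hia | hi <;>
          rcases Finset.mem_insert.1 hj with hja | hj
        · exact absurd (hia.trans hja.symm) hij
        · rw [hia]
          exact (hdich a (Finset.mem_insert_self _ _) j
            (Finset.mem_insert_of_mem (hS' hj))).resolve_left (hex j hj)
        · rw [hja]
          exact ((hdich a (Finset.mem_insert_self _ _) i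
            (Finset.mem_insert_of_mem (hS' hi))).resolve_left (hex i hi)).symm
        · exact hpw i hi j hj hij
      · rcases Finset.mem_insert.1 hi with hia | hi
        · exact ⟨a, Finset.mem_insert_self _ _, by rw [hia]⟩
        · obtain ⟨j, hj, hij⟩ := hcov i hi
          exact ⟨j, Finset.mem_insert_of_mem hj, hij⟩

/-- **`K ∩ cᵢ` is compact** when the compact set `K` is covered by finitely many open sets
`c j` any two of which are equal or disjoint: it is `K` minus the union of the `c j ≠ cᵢ`.
[folklore] -/
theorem isCompact_inter_of_cover {ι : Type*} {K : Set ℂ} (hK : IsCompact K) (S : Finset ι)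
    (c : ι → Set ℂ) (hopen : ∀ i, IsOpen (c i)) (hcov : K ⊆ ⋃ i ∈ S, c i)
    (hdich : ∀ i ∈ S, ∀ j ∈ S, c i = c j ∨ Disjoint (c i) (c j)) {i : ι} (hi : i ∈ S) :
    IsCompact (K ∩ c i) := by
  classical
  set U : Set ℂ := ⋃ j ∈ S.filter (fun j ↦ c j ≠ c i), c j with hU
  have hUo : IsOpen U := isOpen_biUnion fun j _ ↦ hopen j
  have heq : K ∩ c i = K \ U := by
    ext z
    constructor
    · rintro ⟨hzK, hzi⟩
      refine ⟨hzK, fun hzU ↦ ?_⟩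
      obtain ⟨j, hj, hzj⟩ := mem_iUnion₂.1 hzU
      rw [Finset.mem_filter] at hj
      rcases hdich j hj.1 i hi with h | h
      · exact hj.2 h
      · exact Set.disjoint_left.1 h hzj hzi
    · rintro ⟨hzK, hzU⟩
      obtain ⟨j, hj, hzj⟩ := mem_iUnion₂.1 (hcov hzK)
      refine ⟨hzK, ?_⟩
      by_contra hzi
      apply hzU
      refine mem_iUnion₂.2 ⟨j, Finset.mem_filter.2 ⟨hj, fun h ↦ hzi ?_⟩, hzj⟩
      rw [← h]
      exact hzj
  rw [heq]
  exact hK.diff hUo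

/-! ### Marking two frontier points -/

/-- **Prescribing the marked points.** A Jordan domain `J` with two distinct frontier points
`a`, `b` is the carrier of a Dobrushin domain with marked points `a = pt 0`, `b = pt 1` (shift the
boundary loop to start at `a`). [folklore] -/
theorem exists_dobrushinDomain_of_mem_frontier (J : JordanDomain) {a b : ℂ}
    (ha : a ∈ frontier J.carrier) (hb : b ∈ frontier J.carrier) (hab : a ≠ b) :
    ∃ E : DobrushinDomain, E.carrier = J.carrier ∧ E.pt 0 = a ∧ E.pt 1 = b := by
  rw [J.frontier_eq_image_Ico] at ha hb
  obtain ⟨u, hu, rfl⟩ := ha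
  obtain ⟨v, hv, rfl⟩ := hb
  have huv : u ≠ v := fun h ↦ hab (h ▸ rfl)
  set w : ℝ := if u < v then v - u else v - u + 1 with hw
  have hw0 : 0 < w := by
    simp only [hw]
    split_ifs with h
    · linarith
    · linarith [hv.1, hu.2]
  have hw1 : w < 1 := by
    simp only [hw]
    split_ifs with h
    · linarith [hv.2, hu.1]
    · have : v < u := lt_of_le_of_ne (not_lt.1 h) (Ne.symm huv)
      linarith
  have hbw : J.boundary (w + u) = J.boundary v := by
    simp only [hw]
    split_ifs with h
    · congr 1
      ring
    · rw [show v - u + 1 + u = v + 1 by ring, J.periodic_boundary]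
  let J' : JordanDomain :=
    { carrier := J.carrier
      boundary := fun t ↦ J.boundary (t + u)
      isOpen := J.isOpen
      isBounded := J.isBounded
      isConnected := J.isConnected
      continuous_boundary := J.continuous_boundary.comp (continuous_id.add continuous_const)
      periodic_boundary := fun t ↦ by
        show J.boundary (t + 1 + u) = J.boundary (t + u)
        rw [show t + 1 + u = t + u + 1 by ring, J.periodic_boundary]
      injOn_boundary := by
        intro s hs t ht hst
        have := J.injOn_boundary_Ico u ⟨by linarith [hs.1], by linarith [hs.2]⟩
          ⟨by linarith [ht.1], by linarith [ht.2]⟩ hst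
        linarith
      range_boundary := by
        rw [← J.range_boundary]
        ext z
        constructor
        · rintro ⟨t, rfl⟩
          exact ⟨t + u, rfl⟩
        · rintro ⟨t, rfl⟩
          exact ⟨t - u, by simp⟩ }
  refine ⟨{ toJordanDomain := J'
            mark := ![0, w]
            strictMono_mark := ?_
            mark_mem := ?_ }, rfl, ?_, ?_⟩
  · refine Fin.strictMono_iff_lt_succ.2 fun k ↦ ?_
    fin_cases k
    simpa using hw0
  · intro k
    fin_cases k
    · simp
    · simpa using ⟨hw0.le, hw1⟩
  · show J.boundary ((![0, w] : Fin 2 → ℝ) 0 + u) = J.boundary u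
    simp
  · show J.boundary ((![0, w] : Fin 2 → ℝ) 1 + u) = J.boundary v
    simpa using hbw

end Summit.CriticalPhenomena.SAWScalingLimit.Theorems.AvoidancePassage

end
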